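import Mathlib
import HarnessLib
import Literature.MathematicalPhysics.StatisticalMechanics.TorusFRDStepKernelPair
import Literature.MathematicalPhysics.StatisticalMechanics.TorusFRDKernelComparison
import Literature.MathematicalPhysics.StatisticalMechanics.TuningLipschitzPackaging

/-!
# [ABKM19] (7.74)–(7.75) SHELL BY SHELL: the relative change of the multiplier `Re 𝒞̂_{A,k}(κ)` in
# the coefficient matrix is small on the HIGH shells, `≤ K L^{−(k−j)(ñ−n)} · |A − A'|` for `κ ∈ 𝔸_j`,
# `j < k` ([Buc16] (4.33)/(keyquotientbound), preparation of the volume-uniform Lemma 8.4)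

`TorusFRDKernelComparison.re_fourierCoeff_le_one_add_mul_of_torusFRD` bounds the relative change of the
multipliers of the finite-range decomposition along an elliptic segment by the SHELL-UNIFORM ratio
`K = shellRatioConst c C₁ L d ñ = (C₁/c)L^{4(d+ñ)+2}` of the derivative bound to the lower bound of
clause (v).  On the shells `j < k` (momenta above `L^{−k}`, where the kernel of scale `k` is smooth) the
true ratio is smaller by the regularity gap of the decomposition:
`upper_j / lower_j = K · L^{−(k−j)(ñ−n)}` — this decay is what makes the Hilbert–Schmidt norm of the
relative change of covariance summable over the `L^{(N−j)d}` modes of shell `j` when `2(ñ−n) > d`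
([Buc16] proof of Thm 4.5).  This file is the shell-wise refinement:

* `shellRatioConst c C₁ L d ñ / L ^ ((k - j) * (ñ - n)) = shellRatioConst c C₁ L d ñ / L^{(k−j)(ñ−n)}` (`= K` for `k ≤ j`);
* `deriv_shell_bound_le_ratio_div_mul_lower_lt` — `upper_j ≤ K_j · lower_j` for `j < k`;
* **`re_fourierCoeff_le_exp_mul_of_torusFRD_shell`** — along an elliptic segment `A₀ + tB`, `t ∈ [0,T]`,
  for `κ ≠ 0` in shell `j`: `Re 𝒞̂_{A₀+TB,k}(κ) ≤ exp(K_j T) · Re 𝒞̂_{A₀,k}(κ)`, `K_j` the shell-wise ratio;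
* **`abs_re_fourierCoeff_sub_le_shell_of_torusFRD`** — the two-sided form
  `|Re 𝒞̂_{A₀+TB,k}(κ) − Re 𝒞̂_{A₀,k}(κ)| ≤ (K_j e^{2K_j T} T) · Re 𝒞̂(κ)` at BOTH ends;
* **`abs_re_fourierCoeff_one_add_sub_le_shell_of_torusFRD`** — the same for the step kernels
  `𝒞_{1+q,k}`, `𝒞_{1+q',k}` of two small symmetric tuning parameters, `T = Σ|q'−q|`.

Everything is proved; no named fact.

## References
* S. Adams, S. Buchholz, R. Kotecký, S. Müller, arXiv:1910.13564, Lemma 7.7 (7.74)–(7.75), Lemma 8.4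
  [AdamsBuchholzKoteckyMuller2019].
* S. Buchholz, J. Funct. Anal. 275 (2018), Thm 2.4, Thm 4.5 and (4.33)–(4.37) [Buchholz2016].
-/

noncomputable section

namespace Literature.MathematicalPhysics.StatisticalMechanics.GradientRG

open Real Set Finset
open Literature.MathematicalPhysics.StatisticalMechanics.GradientFRD
  (fourierCoeff IsElliptic IsUnitSymm InShell exists_inShell re_fourierCoeff_zero_of_sum_eq_zero)

variable {d M : ℕ} [NeZero M]

/-! ## The shell-wise ratio -/

/-- The shell-wise ratio `K/L^{(k−j)(ñ−n)} ≥ 0`. [cite: Buchholz2016, Thm 4.5 (proof)] -/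
theorem shellRatio_div_nonneg {c C₁ L : ℝ} (hc : 0 < c) (hC₁ : 0 ≤ C₁) (hL : 0 ≤ L) (d n ñ k j : ℕ) :
    0 ≤ shellRatioConst c C₁ L d ñ / L ^ ((k - j) * (ñ - n)) := by
  exact div_nonneg (shellRatioConst_nonneg hc hC₁ hL d ñ) (pow_nonneg hL _)

/-- The shell-wise ratio is at most the uniform one, `K/L^{(k−j)(ñ−n)} ≤ K`, for `L ≥ 1`. [cite: Buchholz2016, Thm 4.5 (proof)] -/
theorem shellRatio_div_le {c C₁ L : ℝ} (hc : 0 < c) (hC₁ : 0 ≤ C₁) (hL : 1 ≤ L) (d n ñ k j : ℕ) :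
    shellRatioConst c C₁ L d ñ / L ^ ((k - j) * (ñ - n)) ≤ shellRatioConst c C₁ L d ñ := by
  exact div_le_self (shellRatioConst_nonneg hc hC₁ (by linarith) d ñ) (one_le_pow₀ hL)

/-- For `k ≤ j` the shell-wise ratio is the uniform one. [cite: Buchholz2016, Thm 4.5 (proof)] -/
theorem shellRatio_div_of_le {c C₁ L : ℝ} {d n ñ k j : ℕ} (hkj : k ≤ j) :
    shellRatioConst c C₁ L d ñ / L ^ ((k - j) * (ñ - n)) = shellRatioConst c C₁ L d ñ := by
  rw [Nat.sub_eq_zero_of_le hkj, zero_mul, pow_zero, div_one]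

/-- **The shells `j < k`, sharp form**:
`C₁ L^{2(d+ñ)+1} L^{2j} / L^{(k−j)(d−1+ñ)} ≤ K_j · (c/L^{2(d+ñ)+1} · L^{2j} / L^{(k−j)(d−1+n)})` with
`K_j = shellRatioConst c C₁ L d ñ / L ^ ((k - j) * (ñ - n))` (in fact an equality), for `L ≥ 1`, `n ≤ ñ`, `c > 0`.
[cite: Buchholz2016, Thm 4.5 (proof, (4.33))] -/
theorem deriv_shell_bound_le_ratio_div_mul_lower_lt {c C₁ L : ℝ} {d n ñ j k : ℕ} (hc : 0 < c)
    (hL : 1 ≤ L) (hn : n ≤ ñ) :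
    C₁ * L ^ (2 * (d + ñ) + 1) * L ^ (2 * j) / L ^ ((k - j) * (d - 1 + ñ)) ≤
      shellRatioConst c C₁ L d ñ / L ^ ((k - j) * (ñ - n)) *
        (c / L ^ (2 * (d + ñ) + 1) * L ^ (2 * j) / L ^ ((k - j) * (d - 1 + n))) := by
  have hL0 : 0 < L := by linarith
  unfold shellRatioConst
  have hsplit : L ^ ((k - j) * (d - 1 + ñ)) = L ^ ((k - j) * (ñ - n)) * L ^ ((k - j) * (d - 1 + n)) := by
    rw [← pow_add]; congr 1
    have : d - 1 + ñ = (ñ - n) + (d - 1 + n) := by omega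
    rw [this]; ring
  have hsq : L ^ (4 * (d + ñ) + 2) = L ^ (2 * (d + ñ) + 1) * L ^ (2 * (d + ñ) + 1) := by
    rw [← pow_add]; congr 1; ring
  rw [hsplit, hsq]
  refine le_of_eq ?_
  field_simp

/-! ## `(7.75)` shell by shell along an elliptic segment -/

section Segment

variable {𝒞A : Matrix (Fin d) (Fin d) ℝ → ℕ → (Fin d → ZMod M) → ℝ} {ω₀ Ω₀ c C : ℝ} {Cℓ : ℕ → ℝ}
    {Cα : (Fin d → ℕ) → ℕ → ℝ} {L N n ñ : ℕ}

/-- **`Re 𝒞̂_{A₀+TB,k}(κ) ≤ exp(K_j T) · Re 𝒞̂_{A₀,k}(κ)` for `κ ≠ 0` in shell `j`**, along an elliptic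
segment `A₀ + tB`, `t ∈ [0,T]`, `B` unit symmetric, `1 ≤ k ≤ N+1`, with the SHELL-WISE ratio
`K_j = shellRatioConst c (Cℓ 1) L d ñ / L^{(k−j)(ñ−n)}` (clauses (iv), (v) of `TorusFRD`, `n ≤ ñ`, `L ≥ 1`).
[cite: Buchholz2016, Thm 4.5 (proof, (4.33))] -/
theorem re_fourierCoeff_le_exp_mul_of_torusFRD_shell
    (hiv : ∀ A : Matrix (Fin d) (Fin d) ℝ, IsElliptic ω₀ Ω₀ A →
      ∀ k, 1 ≤ k → k ≤ N + 1 → ∀ B : Matrix (Fin d) (Fin d) ℝ, IsUnitSymm B →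
        (∃ ε : ℝ, 0 < ε ∧ ∀ x : Fin d → ZMod M,
          ContDiffOn ℝ ⊤ (fun s : ℝ => 𝒞A (A + s • B) k x) (Set.Ioo (-ε) ε)) ∧
        ∀ α : Fin d → ℕ, ∑ i, α i ≤ n → ∀ ℓ : ℕ, ∀ x : Fin d → ZMod M,
          abs (iteratedDeriv ℓ (fun s : ℝ => GradientFRD.iterDiff α (𝒞A (A + s • B) k) x) 0)
            ≤ Cα α ℓ / (L : ℝ) ^ ((k - 1) * (d - 2 + ∑ i, α i)))
    (hv : ∀ A : Matrix (Fin d) (Fin d) ℝ, IsElliptic ω₀ Ω₀ A →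
      ∀ k, 1 ≤ k → k ≤ N + 1 → ∀ j : ℕ, ∀ κ : Fin d → ZMod M, κ ≠ 0 → InShell L j κ →
        (j < k →
          c / (L : ℝ) ^ (2 * (d + ñ) + 1) * (L : ℝ) ^ (2 * j)
              / (L : ℝ) ^ ((k - j) * (d - 1 + n)) ≤ (fourierCoeff (𝒞A A k) κ).re ∧
          ‖fourierCoeff (𝒞A A k) κ‖
            ≤ C * (L : ℝ) ^ (2 * (d + ñ) + 1) * (L : ℝ) ^ (2 * j)
                / (L : ℝ) ^ ((k - j) * (d - 1 + n))) ∧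
        (k ≤ j →
          c / (L : ℝ) ^ (2 * (d + ñ) + 1) * (L : ℝ) ^ (2 * k)
              ≤ (fourierCoeff (𝒞A A k) κ).re ∧
          ‖fourierCoeff (𝒞A A k) κ‖ ≤ C * (L : ℝ) ^ (2 * k)) ∧
        ∀ B : Matrix (Fin d) (Fin d) ℝ, IsUnitSymm B → ∀ ℓ : ℕ, 1 ≤ ℓ →
          (j < k →
            ‖iteratedDeriv ℓ (fun s : ℝ => fourierCoeff (𝒞A (A + s • B) k) κ) 0‖
              ≤ Cℓ ℓ * (L : ℝ) ^ (2 * (d + ñ) + 1) * (L : ℝ) ^ (2 * j)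
                  / (L : ℝ) ^ ((k - j) * (d - 1 + ñ))) ∧
          (k ≤ j →
            ‖iteratedDeriv ℓ (fun s : ℝ => fourierCoeff (𝒞A (A + s • B) k) κ) 0‖
              ≤ Cℓ ℓ * (L : ℝ) ^ (2 * k)))
    (hc : 0 < c) (hC1 : 0 ≤ Cℓ 1) (hL : 1 ≤ L) (hn : n ≤ ñ)
    {A₀ B : Matrix (Fin d) (Fin d) ℝ} (hB : IsUnitSymm B) {T : ℝ} (hT : 0 ≤ T)
    (hell : ∀ t ∈ Icc 0 T, IsElliptic ω₀ Ω₀ (A₀ + t • B))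
    {k : ℕ} (hk1 : 1 ≤ k) (hkN : k ≤ N + 1) {κ : Fin d → ZMod M} (hκ : κ ≠ 0) {j : ℕ}
    (hj : InShell L j κ) :
    (fourierCoeff (𝒞A (A₀ + T • B) k) κ).re ≤
      exp ((shellRatioConst c (Cℓ 1) (L : ℝ) d ñ / (L : ℝ) ^ ((k - j) * (ñ - n))) * T) * (fourierCoeff (𝒞A A₀ k) κ).re := by
  have hLr : (1 : ℝ) ≤ (L : ℝ) := by exact_mod_cast hL
  have hL0 : (0 : ℝ) < (L : ℝ) := by linarith
  have hK : 0 ≤ (shellRatioConst c (Cℓ 1) (L : ℝ) d ñ / (L : ℝ) ^ ((k - j) * (ñ - n))) := shellRatio_div_nonneg hc hC1 hL0.le d n ñ k j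
  -- differentiability of the real-space values along the segment (clause (iv))
  have hdiff : ∀ t ∈ Icc 0 T, ∀ x, DifferentiableAt ℝ
      (fun s : ℝ => (fun A => 𝒞A A k) (A₀ + t • B + s • B) x) 0 := by
    intro t ht x
    obtain ⟨ε, hε, hcd⟩ := (hiv (A₀ + t • B) (hell t ht) k hk1 hkN B hB).1
    have hmem : Set.Ioo (-ε) ε ∈ nhds (0 : ℝ) := Ioo_mem_nhds (by linarith) hε
    exact ((hcd x).differentiableOn (by simp)).differentiableAt hmem
  have hder : ∀ t ∈ Icc 0 T,
      ‖deriv (fun s : ℝ => fourierCoeff ((fun A => 𝒞A A k) (A₀ + t • B + s • B)) κ) 0‖ =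
        ‖iteratedDeriv 1 (fun s : ℝ => fourierCoeff (𝒞A ((A₀ + t • B) + s • B) k) κ) 0‖ := by
    intro t _; rw [iteratedDeriv_one]
  rcases lt_or_ge j k with hjk | hkj
  · -- shells `j < k`: the sharp ratio
    set lower : ℝ := c / (L : ℝ) ^ (2 * (d + ñ) + 1) * (L : ℝ) ^ (2 * j) / (L : ℝ) ^ ((k - j) * (d - 1 + n))
      with hlower
    set upper : ℝ := Cℓ 1 * (L : ℝ) ^ (2 * (d + ñ) + 1) * (L : ℝ) ^ (2 * j) / (L : ℝ) ^ ((k - j) * (d - 1 + ñ))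
      with hupper
    have hlow : ∀ t ∈ Icc 0 T, lower ≤ (fourierCoeff ((fun A => 𝒞A A k) (A₀ + t • B)) κ).re :=
      fun t ht => ((hv (A₀ + t • B) (hell t ht) k hk1 hkN j κ hκ hj).1 hjk).1
    have hup : ∀ t ∈ Icc 0 T,
        ‖deriv (fun s : ℝ => fourierCoeff ((fun A => 𝒞A A k) (A₀ + t • B + s • B)) κ) 0‖ ≤ upper := by
      intro t ht
      rw [hder t ht]
      exact ((hv (A₀ + t • B) (hell t ht) k hk1 hkN j κ hκ hj).2.2 B hB 1 le_rfl).1 hjk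
    have hratio : upper ≤ (shellRatioConst c (Cℓ 1) (L : ℝ) d ñ / (L : ℝ) ^ ((k - j) * (ñ - n))) * lower :=
      deriv_shell_bound_le_ratio_div_mul_lower_lt hc hLr hn
    exact re_fourierCoeff_segment_le_exp_mul (𝒦 := fun A => 𝒞A A k) hT κ hdiff hup hlow hK hratio
  · -- shells `k ≤ j`: the uniform ratio
    set lower : ℝ := c / (L : ℝ) ^ (2 * (d + ñ) + 1) * (L : ℝ) ^ (2 * k) with hlower
    set upper : ℝ := Cℓ 1 * (L : ℝ) ^ (2 * k) with hupper
    have hlow : ∀ t ∈ Icc 0 T, lower ≤ (fourierCoeff ((fun A => 𝒞A A k) (A₀ + t • B)) κ).re :=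
      fun t ht => ((hv (A₀ + t • B) (hell t ht) k hk1 hkN j κ hκ hj).2.1 hkj).1
    have hup : ∀ t ∈ Icc 0 T,
        ‖deriv (fun s : ℝ => fourierCoeff ((fun A => 𝒞A A k) (A₀ + t • B + s • B)) κ) 0‖ ≤ upper := by
      intro t ht
      rw [hder t ht]
      exact ((hv (A₀ + t • B) (hell t ht) k hk1 hkN j κ hκ hj).2.2 B hB 1 le_rfl).2 hkj
    have hratio : upper ≤ (shellRatioConst c (Cℓ 1) (L : ℝ) d ñ / (L : ℝ) ^ ((k - j) * (ñ - n))) * lower := by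
      rw [shellRatio_div_of_le hkj]
      exact deriv_shell_bound_le_ratio_mul_lower_le hc hC1 hLr
    exact re_fourierCoeff_segment_le_exp_mul (𝒦 := fun A => 𝒞A A k) hT κ hdiff hup hlow hK hratio

/-- Elementary: from `a ≤ e^{x} b`, `b ≤ e^{x} a`, `b ≥ 0`, `x ≥ 0`: `|b − a| ≤ (x e^{2x}) · b`.
[cite: AdamsBuchholzKoteckyMuller2019, Lemma 12.6 (12.52)] -/
theorem abs_sub_le_mul_of_le_exp_mul {a b x : ℝ} (hx : 0 ≤ x) (hb : 0 ≤ b) (h₁ : a ≤ exp x * b)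
    (h₂ : b ≤ exp x * a) : |b - a| ≤ x * exp (2 * x) * b := by
  set τ := exp x - 1 with hτ
  have hτ0 : 0 ≤ τ := by have := one_le_exp hx; rw [hτ]; linarith
  have he : exp x = 1 + τ := by rw [hτ]; ring
  rw [he] at h₁ h₂
  have h := abs_sub_le_of_two_sided hτ0 hb h₁ h₂
  refine h.trans (mul_le_mul_of_nonneg_right ?_ hb)
  have h1 : τ * (1 + τ) ≤ x * exp (2 * x * 1) * 1 := by
    have := exp_mul_sub_one_mul_le (K := x) (t := 1) (T₁ := 1) hx zero_le_one le_rfl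
    rw [mul_one] at this
    exact this
  simpa using h1

/-- **Two-sided shell-wise closeness along an elliptic segment** (package with clauses (o), (iv), (v)):
for `κ ≠ 0` in shell `j`, `1 ≤ k ≤ N+1`, `B` unit symmetric, the segment `A₀ + tB`, `t ∈ [0,T]`, elliptic,
with `K_j = shellRatioConst c (Cℓ 1) L d ñ / L^{(k−j)(ñ−n)}`:
`|Re 𝒞̂_{A₀+TB,k}(κ) − Re 𝒞̂_{A₀,k}(κ)| ≤ (K_j T e^{2K_j T}) · Re 𝒞̂_{A₀+TB,k}(κ)` and `≤ (K_j T e^{2K_j T}) · Re 𝒞̂_{A₀,k}(κ)`.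
[cite: AdamsBuchholzKoteckyMuller2019, Lemma 7.7 (7.75)] -/
theorem abs_re_fourierCoeff_sub_le_shell_of_torusFRD
    (hiv : ∀ A : Matrix (Fin d) (Fin d) ℝ, IsElliptic ω₀ Ω₀ A →
      ∀ k, 1 ≤ k → k ≤ N + 1 → ∀ B : Matrix (Fin d) (Fin d) ℝ, IsUnitSymm B →
        (∃ ε : ℝ, 0 < ε ∧ ∀ x : Fin d → ZMod M,
          ContDiffOn ℝ ⊤ (fun s : ℝ => 𝒞A (A + s • B) k x) (Set.Ioo (-ε) ε)) ∧
        ∀ α : Fin d → ℕ, ∑ i, α i ≤ n → ∀ ℓ : ℕ, ∀ x : Fin d → ZMod M,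
          abs (iteratedDeriv ℓ (fun s : ℝ => GradientFRD.iterDiff α (𝒞A (A + s • B) k) x) 0)
            ≤ Cα α ℓ / (L : ℝ) ^ ((k - 1) * (d - 2 + ∑ i, α i)))
    (hv : ∀ A : Matrix (Fin d) (Fin d) ℝ, IsElliptic ω₀ Ω₀ A →
      ∀ k, 1 ≤ k → k ≤ N + 1 → ∀ j : ℕ, ∀ κ : Fin d → ZMod M, κ ≠ 0 → InShell L j κ →
        (j < k →
          c / (L : ℝ) ^ (2 * (d + ñ) + 1) * (L : ℝ) ^ (2 * j)
              / (L : ℝ) ^ ((k - j) * (d - 1 + n)) ≤ (fourierCoeff (𝒞A A k) κ).re ∧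
          ‖fourierCoeff (𝒞A A k) κ‖
            ≤ C * (L : ℝ) ^ (2 * (d + ñ) + 1) * (L : ℝ) ^ (2 * j)
                / (L : ℝ) ^ ((k - j) * (d - 1 + n))) ∧
        (k ≤ j →
          c / (L : ℝ) ^ (2 * (d + ñ) + 1) * (L : ℝ) ^ (2 * k)
              ≤ (fourierCoeff (𝒞A A k) κ).re ∧
          ‖fourierCoeff (𝒞A A k) κ‖ ≤ C * (L : ℝ) ^ (2 * k)) ∧
        ∀ B : Matrix (Fin d) (Fin d) ℝ, IsUnitSymm B → ∀ ℓ : ℕ, 1 ≤ ℓ →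
          (j < k →
            ‖iteratedDeriv ℓ (fun s : ℝ => fourierCoeff (𝒞A (A + s • B) k) κ) 0‖
              ≤ Cℓ ℓ * (L : ℝ) ^ (2 * (d + ñ) + 1) * (L : ℝ) ^ (2 * j)
                  / (L : ℝ) ^ ((k - j) * (d - 1 + ñ))) ∧
          (k ≤ j →
            ‖iteratedDeriv ℓ (fun s : ℝ => fourierCoeff (𝒞A (A + s • B) k) κ) 0‖
              ≤ Cℓ ℓ * (L : ℝ) ^ (2 * k)))
    (hc : 0 < c) (hC1 : 0 ≤ Cℓ 1) (hL : 2 ≤ L) (hn : n ≤ ñ)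
    {A₀ B : Matrix (Fin d) (Fin d) ℝ} (hB : IsUnitSymm B) {T : ℝ} (hT : 0 ≤ T)
    (hell : ∀ t ∈ Icc 0 T, IsElliptic ω₀ Ω₀ (A₀ + t • B))
    {k : ℕ} (hk1 : 1 ≤ k) (hkN : k ≤ N + 1) {κ : Fin d → ZMod M} (hκ : κ ≠ 0) {j : ℕ}
    (hj : InShell L j κ) :
    |(fourierCoeff (𝒞A (A₀ + T • B) k) κ).re - (fourierCoeff (𝒞A A₀ k) κ).re| ≤
        (shellRatioConst c (Cℓ 1) (L : ℝ) d ñ / (L : ℝ) ^ ((k - j) * (ñ - n))) * T *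
            exp (2 * ((shellRatioConst c (Cℓ 1) (L : ℝ) d ñ / (L : ℝ) ^ ((k - j) * (ñ - n))) * T)) *
          (fourierCoeff (𝒞A (A₀ + T • B) k) κ).re ∧
      |(fourierCoeff (𝒞A (A₀ + T • B) k) κ).re - (fourierCoeff (𝒞A A₀ k) κ).re| ≤
        (shellRatioConst c (Cℓ 1) (L : ℝ) d ñ / (L : ℝ) ^ ((k - j) * (ñ - n))) * T *
            exp (2 * ((shellRatioConst c (Cℓ 1) (L : ℝ) d ñ / (L : ℝ) ^ ((k - j) * (ñ - n))) * T)) *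
          (fourierCoeff (𝒞A A₀ k) κ).re := by
  have hL1 : 1 ≤ L := by omega
  have hL0 : (0 : ℝ) ≤ (L : ℝ) := Nat.cast_nonneg _
  set Kj := (shellRatioConst c (Cℓ 1) (L : ℝ) d ñ / (L : ℝ) ^ ((k - j) * (ñ - n))) with hKj
  have hKj0 : 0 ≤ Kj := shellRatio_div_nonneg hc hC1 hL0 d n ñ k j
  have hx : 0 ≤ Kj * T := mul_nonneg hKj0 hT
  have hell0 : IsElliptic ω₀ Ω₀ A₀ := by simpa using hell 0 ⟨le_rfl, hT⟩
  have hellT : IsElliptic ω₀ Ω₀ (A₀ + T • B) := hell T ⟨hT, le_rfl⟩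
  -- forward
  have hfwd := re_fourierCoeff_le_exp_mul_of_torusFRD_shell hiv hv hc hC1 hL1 hn hB hT hell hk1 hkN hκ hj
  -- backward along the reversed segment `(A₀ + TB) + t(−B)`
  have hell' : ∀ t ∈ Icc 0 T, IsElliptic ω₀ Ω₀ (A₀ + T • B + t • (-B)) := by
    intro t ht
    have hmem : T - t ∈ Icc 0 T := ⟨by linarith [ht.2], by linarith [ht.1]⟩
    have := hell (T - t) hmem
    convert this using 1
    rw [sub_smul, smul_neg, add_assoc, ← sub_eq_add_neg]
  have hbwd := re_fourierCoeff_le_exp_mul_of_torusFRD_shell hiv hv hc hC1 hL1 hn (isUnitSymm_neg hB) hT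
    hell' hk1 hkN hκ hj
  have hend : A₀ + T • B + T • (-B) = A₀ := by rw [smul_neg, add_neg_cancel_right]
  rw [hend] at hbwd
  have hposT : 0 ≤ (fourierCoeff (𝒞A (A₀ + T • B) k) κ).re :=
    (re_fourierCoeff_pos_of_torusFRD (hv _ hellT) hc hL hk1 hkN hκ).le
  have hpos0 : 0 ≤ (fourierCoeff (𝒞A A₀ k) κ).re :=
    (re_fourierCoeff_pos_of_torusFRD (hv _ hell0) hc hL hk1 hkN hκ).le
  refine ⟨?_, ?_⟩
  · exact abs_sub_le_mul_of_le_exp_mul hx hposT hbwd hfwd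
  · rw [abs_sub_comm]
    exact abs_sub_le_mul_of_le_exp_mul hx hpos0 hfwd hbwd

end Segment

/-! ## The step kernels of two small tuning parameters -/

section Package

variable {L N n ñ : ℕ} {𝒞 : Matrix (Fin d) (Fin d) ℝ → ℕ → (Fin d → ZMod M) → ℝ}
    {Cα : (Fin d → ℕ) → ℕ → ℝ} {c C : ℝ} {Cℓ : ℕ → ℝ}

/-- **Two-sided shell-wise closeness of `Re 𝒞̂_{1+q',k}(κ)` and `Re 𝒞̂_{1+q,k}(κ)`** for symmetric `q, q'`
with `Σ|q|, Σ|q'| ≤ ½` (the segment between them is elliptic), `1 ≤ k ≤ N+1`: with `T = Σ|q'−q|`,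
`K_j = shellRatioConst c (Cℓ 1) L d ñ / L^{(k−j)(ñ−n)}`, `ρ_j = K_j T e^{2 K_j T}`, for every `κ ≠ 0` in shell `j`
`|Re 𝒞̂_{1+q',k}(κ) − Re 𝒞̂_{1+q,k}(κ)| ≤ ρ_j · Re 𝒞̂_{1+q',k}(κ)` and `≤ ρ_j · Re 𝒞̂_{1+q,k}(κ)`.
[cite: AdamsBuchholzKoteckyMuller2019, Lemma 7.7 (7.75)] -/
theorem abs_re_fourierCoeff_one_add_sub_le_shell_of_torusFRD
    (hiv : ∀ A : Matrix (Fin d) (Fin d) ℝ, IsElliptic (1 / 2 : ℝ) 2 A →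
      ∀ k, 1 ≤ k → k ≤ N + 1 → ∀ B : Matrix (Fin d) (Fin d) ℝ, IsUnitSymm B →
        (∃ ε : ℝ, 0 < ε ∧ ∀ x : Fin d → ZMod M,
          ContDiffOn ℝ ⊤ (fun s : ℝ => 𝒞 (A + s • B) k x) (Set.Ioo (-ε) ε)) ∧
        ∀ α : Fin d → ℕ, ∑ i, α i ≤ n → ∀ ℓ : ℕ, ∀ x : Fin d → ZMod M,
          abs (iteratedDeriv ℓ (fun s : ℝ => GradientFRD.iterDiff α (𝒞 (A + s • B) k) x) 0)
            ≤ Cα α ℓ / (L : ℝ) ^ ((k - 1) * (d - 2 + ∑ i, α i)))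
    (hv : ∀ A : Matrix (Fin d) (Fin d) ℝ, IsElliptic (1 / 2 : ℝ) 2 A →
      ∀ k, 1 ≤ k → k ≤ N + 1 → ∀ j : ℕ, ∀ κ : Fin d → ZMod M, κ ≠ 0 → InShell L j κ →
        (j < k →
          c / (L : ℝ) ^ (2 * (d + ñ) + 1) * (L : ℝ) ^ (2 * j)
              / (L : ℝ) ^ ((k - j) * (d - 1 + n)) ≤ (fourierCoeff (𝒞 A k) κ).re ∧
          ‖fourierCoeff (𝒞 A k) κ‖
            ≤ C * (L : ℝ) ^ (2 * (d + ñ) + 1) * (L : ℝ) ^ (2 * j)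
                / (L : ℝ) ^ ((k - j) * (d - 1 + n))) ∧
        (k ≤ j →
          c / (L : ℝ) ^ (2 * (d + ñ) + 1) * (L : ℝ) ^ (2 * k)
              ≤ (fourierCoeff (𝒞 A k) κ).re ∧
          ‖fourierCoeff (𝒞 A k) κ‖ ≤ C * (L : ℝ) ^ (2 * k)) ∧
        ∀ B : Matrix (Fin d) (Fin d) ℝ, IsUnitSymm B → ∀ ℓ : ℕ, 1 ≤ ℓ →
          (j < k →
            ‖iteratedDeriv ℓ (fun s : ℝ => fourierCoeff (𝒞 (A + s • B) k) κ) 0‖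
              ≤ Cℓ ℓ * (L : ℝ) ^ (2 * (d + ñ) + 1) * (L : ℝ) ^ (2 * j)
                  / (L : ℝ) ^ ((k - j) * (d - 1 + ñ))) ∧
          (k ≤ j →
            ‖iteratedDeriv ℓ (fun s : ℝ => fourierCoeff (𝒞 (A + s • B) k) κ) 0‖
              ≤ Cℓ ℓ * (L : ℝ) ^ (2 * k)))
    (hc : 0 < c) (hC1 : 0 ≤ Cℓ 1) (hL : 2 ≤ L) (hnñ : n ≤ ñ)
    {q q' : Matrix (Fin d) (Fin d) ℝ} (hq : q.IsSymm) (hq' : q'.IsSymm)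
    (hq2 : ∑ i, ∑ j, |q i j| ≤ 1 / 2) (hq'2 : ∑ i, ∑ j, |q' i j| ≤ 1 / 2)
    {k : ℕ} (hk1 : 1 ≤ k) (hkN : k ≤ N + 1) {κ : Fin d → ZMod M} (hκ : κ ≠ 0) {j : ℕ}
    (hj : InShell L j κ) :
    |(fourierCoeff (𝒞 ((1 : Matrix (Fin d) (Fin d) ℝ) + q') k) κ).re -
        (fourierCoeff (𝒞 ((1 : Matrix (Fin d) (Fin d) ℝ) + q) k) κ).re| ≤
        (shellRatioConst c (Cℓ 1) (L : ℝ) d ñ / (L : ℝ) ^ ((k - j) * (ñ - n))) * (∑ i, ∑ j, |(q' - q) i j|) *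
            exp (2 * ((shellRatioConst c (Cℓ 1) (L : ℝ) d ñ / (L : ℝ) ^ ((k - j) * (ñ - n))) * ∑ i, ∑ j, |(q' - q) i j|)) *
          (fourierCoeff (𝒞 ((1 : Matrix (Fin d) (Fin d) ℝ) + q') k) κ).re ∧
      |(fourierCoeff (𝒞 ((1 : Matrix (Fin d) (Fin d) ℝ) + q') k) κ).re -
          (fourierCoeff (𝒞 ((1 : Matrix (Fin d) (Fin d) ℝ) + q) k) κ).re| ≤
        (shellRatioConst c (Cℓ 1) (L : ℝ) d ñ / (L : ℝ) ^ ((k - j) * (ñ - n))) * (∑ i, ∑ j, |(q' - q) i j|) *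
            exp (2 * ((shellRatioConst c (Cℓ 1) (L : ℝ) d ñ / (L : ℝ) ^ ((k - j) * (ñ - n))) * ∑ i, ∑ j, |(q' - q) i j|)) *
          (fourierCoeff (𝒞 ((1 : Matrix (Fin d) (Fin d) ℝ) + q) k) κ).re := by
  set T := ∑ i, ∑ j, |(q' - q) i j| with hTdef
  have hT0 : 0 ≤ T := sum_nonneg fun _ _ => sum_nonneg fun _ _ => abs_nonneg _
  rcases hT0.eq_or_lt with hT | hT
  · -- `q' = q`
    have hqq : q' = q := by
      have hz : q' - q = 0 := by
        ext i j
        have hle : |(q' - q) i j| ≤ T :=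
          (single_le_sum (f := fun j => |(q' - q) i j|) (fun _ _ => abs_nonneg _) (mem_univ j)).trans
            (single_le_sum (f := fun i => ∑ j, |(q' - q) i j|)
              (fun _ _ => sum_nonneg fun _ _ => abs_nonneg _) (mem_univ i))
        have : |(q' - q) i j| = 0 := le_antisymm (hT ▸ hle) (abs_nonneg _)
        simpa using this
      exact sub_eq_zero.1 hz
    rw [hqq, sub_self, abs_zero, ← hT]
    simp only [mul_zero, zero_mul]
    exact ⟨le_rfl, le_rfl⟩
  · -- a genuine segment
    set B : Matrix (Fin d) (Fin d) ℝ := T⁻¹ • (q' - q) with hBdef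
    have hBu : IsUnitSymm B := isUnitSymm_direction hq hq' hT le_rfl
    have hell : ∀ t ∈ Icc (0 : ℝ) T,
        IsElliptic (1 / 2 : ℝ) 2 ((1 : Matrix (Fin d) (Fin d) ℝ) + q + t • B) :=
      isElliptic_segment_of_entrySum_le hq hq' hq2 hq'2 hT
    have hend : (1 : Matrix (Fin d) (Fin d) ℝ) + q + T • B = 1 + q' := segment_end hT.ne'
    have h := abs_re_fourierCoeff_sub_le_shell_of_torusFRD hiv hv hc hC1 hL hnñ hBu hT0 hell hk1 hkN hκ hj
    rw [hend] at h
    exact h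

end Package

end Literature.MathematicalPhysics.StatisticalMechanics.GradientRG

end
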